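import Summits.HodgeConjecture.HodgeConjecture.Theorems.R90S1ClosureE3Defs         -- ★ D1 (typ2), the DEFINITIONS of socket 1 (law L9): `ExtE3`, `ExtE3Fin`, `ExtE3Arch`, `ExtE3FinDatum`, `IsRecordDatumG`
import Summits.HodgeConjecture.HodgeConjecture.Theorems.R90S1ClosureE3DefsCM       -- ★ D1-CM (typ2 (g3)), ED. 2 socket-1 TYPE (J-34-9 ∕ LEAD #40 WEAKENING OF RECORD): `ExtE3CM = ExtE3Fin ∧ ExtE3ArchCM`, `ExtE3.toCM`
import Summits.HodgeConjecture.HodgeConjecture.Theorems.R90S1ClosureE3TwistedDefs  -- ★ D2 (typ1, p862674), the DEFINITIONS of socket 2: `ExtE3Tw` {`CharRegularTw`, `KRTwistedDensity`, `TwCasselmanProp74`}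
import HarnessLib

/-!
# R90-TF · S1 (Rogawski 1990 Ch. 12, local) · FILE C — `R90_S1_ClosureE3C`: the (E3) CLOSURE SOCKET OF RECORD «local harmonic analysis» = BUILD TARGET

Cell hodgecm-mathlib, slab R90-TF (director brief v2), section S1 «Ch10-local» (base R90-C10), crux item h413 = stmt-HodgeConjecture-24833 (route
`route-HodgeConjecture-HCCMUnconditional`).  Pen: R90-C10-typ2 (g2), AUTHOR OF RECORD of the E3 home (RULING R-S1-7 + DEAL S1 WAVE E3 «CLOSURE SOCKET OF RECORD (E3)
= BUILD TARGET», R90-C10-plan (g0) 2026-09-04T22:11:35Z — NR-4 FINAL s1997 (1), LEAD #20∕#27 (R1)(R2): OWNER S1, decl `stub_R90_ext_E3`; HEADS-C.v1 7798dd0d9ab22ca8;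
R-S1-7′ 22:20:02Z; «=» AS WRITTEN 22:25:57Z (N1 «= Gqs», N2 «= LeThree»); R-S1-8 (stamp quote) 22:33:35Z; R-S1-9 (de-tag) 22:43:53Z;
audit PRE-READ R90-C10-audit1 (g0) 22:14:29Z ∕ 22:25:30Z PASS; AUDIT BOX S1#E3-D1 PART 1 22:43:34Z no blocking; ★ D2 p862674 22:46Z).  ED. 1 (1dec71c7b09c ≡ 1d7db748bf63fb27,
BUILT K35).

ED. 2 — E3.R2 TYPE WEAKENED TO CM (J-34-9); every other byte preserved.  Pen of ED. 2: R90-C10-typ2 (g3) (junction J-34-9, szE3.4 (g3) 23:14:24Z: ★ D1's rows E3.R2 bind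
`∀ (L : Type) [Field L] (α) (w)` while the ★ payers `archTorusOrbitalOneSidedLimits_holds` ∕ `archLimitFormulaNoncompactWall_holds` bind `[NumberField L] [IsCMField L]`; dealer
R-S1-14 23:36:28Z; R90-TF LEAD #40 (A) 23:38:18Z «ADMITTED as an OPENLY-LABELLED WEAKENING, in ADDITIVE FORM»: ★ D1-CM `R90S1ClosureE3DefsCM` (`ExtE3ArchCM`, `ExtE3CM`,
`ExtE3.toCM`), then this edition).  THE ONLY CHANGES: socket 1's TYPE `ExtE3` ↦ `ExtE3CM` (= ★ `ExtE3Fin ∧ ExtE3ArchCM`: rows E3.R2 `archLimitOneSided` ∕ `archLimitFormula` now bind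
`∀ (L : Type) [Field L] [NumberField L] [IsCMField L] (α) (w)`; rows E3.P* R1 R5 byte-identical), its NAME `stub_R90_ext_E3` UNCHANGED; the forced consequences — import of ★ D1-CM,
head `extE3Arch_of_extE3 : ExtE3ArchCM`, heads `archLimitOneSided_of_extE3` ∕ `archLimitFormula_of_extE3` gain the binders `[NumberField L] [IsCMField L]`, and the prose names the
ED. 2 type where it names the socket's type; socket 2 `stub_R90_ext_E3_tw : ExtE3Tw` and every other head byte-identical.  WHY (LEAD #40 under NR-4): the freeze protects consumers
from goalpost moves; no consumer on any path reads a non-CM `L` (R90-C10-audit1 fact (4); h413 quantifies over CM `L` only), and the ∀-field rows would cost a transport brick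
(1–3 kLoC, szE3.4) for generality nobody consumes; the ED. 1 type still feeds the ED. 2 type by ★ `ExtE3.toCM`.  R90 closure DAG r6 row E3.R2 := «CM-bound».

WHAT THIS FILE IS.  EXACTLY TWO CLOSED SOCKETS — the closure socket of record `stub_R90_ext_E3 : ExtE3CM` (a CLOSED `Prop`, ★ `R90S1ClosureE3DefsCM.ExtE3CM = ExtE3Fin ∧
ExtE3ArchCM`, ED. 2 — rows E3.R2 CM-bound; ED. 1 typed ★ `R90S1ClosureE3Defs.ExtE3 = ExtE3Fin ∧ ExtE3Arch`, which implies it by ★ `ExtE3.toCM`; CLOSURE TARGET,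
R90_CLOSURE_DAG rows E3.P1 P3 P5 P6 P10 R1 R2 R5; CLOSURE-E3.md ED. 1 (R90-szE3 (g1)); NR-4 FINAL: a BUILD TARGET above Mathlib, never a
citation) and its ε-TWISTED companion `stub_R90_ext_E3_tw : ExtE3Tw` (★ `R90S1ClosureE3TwistedDefs.ExtE3Tw`, typ1 (g2); rows E3.P2 P7.3 P9: [C₂] twisted character
regularity, [KR] twisted density (∗)-form, [R₃] Prop. 7.4 twisted Casselman; J-E3-TW folded at ED. 1 because ★ D2 landed first, K2-defs1 (g7) 22:46:21Z) —
plus the sorry-free PROJECTION HEADS the sections above (S1 A∕B, S3, S4, S5, S10, the K2E3 organ's tier-0 stubs 1–2) cite BY NAME.  LAW L9 «DEFINITIONS DOWN»: every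
definition the socket's TYPE mentions lives in the ★ `Theorems` file `R90S1ClosureE3Defs` (same namespace), so every PAYER states and proves a conjunct of `ExtE3`
in its own ★ `Theorems` file WITHOUT importing this file; this file imports ★ `Theorems` + `HarnessLib` only (no `Cruxes/…/Lines` import — no cycle with S1 A∕B,
S4-B, S10, or the organ).  The sockets are NEVER dealt to provers and NEVER `skeleton check`ed; they are FROZEN once written (JUNCTION RULE: any re-socketing elsewhere is
byte-identical to `theorem stub_R90_ext_E3 : ExtE3CM` ∕ `theorem stub_R90_ext_E3_tw : ExtE3Tw`).  Socket 1 closes when a ★ `Theorems` file proves `theorem … : ExtE3CM`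
(or the stronger ★ `ExtE3`, via ★ `ExtE3.toCM`) — i.e. when every fielded row is BUILT:
(α) `ExtE3Fin.regularity = characterLocallyIntegrableLeThree` (E3.P1) and `ExtE3Fin.normCharLocBdd = normalizedCharacter_locallyBoundedLeThree` (E3.P10) — the ★ NR-1′
LeThree letters (`2 ≤ N ≤ 3`, non-split `v`; R-S1-7′ (α); = the organ's L4 tier-0 ED. 4 stubs 1–2 BY TYPE; the ∀ `N` Literature Props are NR-1′ S-layer, not fielded), `ExtE3ArchCM.cdPseudoCoeff = ArchPacketSignsLetter` (E3.R1; = S10-E `stub_R90_ext_pseudoCoeffDS_u` BY TYPE), `ExtE3ArchCM.archLimitOneSided ∕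
archLimitFormula` (E3.R2, CM-bound from ED. 2: payable BY NAME by ★ `archTorusOrbitalOneSidedLimits_holds` ∕ ★ `archLimitFormulaNoncompactWall_holds`), `ExtE3ArchCM.archCharLinIndep` (E3.R5); (β) `ExtE3Fin.datum` (E3.P3 P5 P6): at every non-split finite place of a CM field, every §12.5 datum on
`U(Φ₃)(L⁺_v) × (U(Φ₂) × U(Φ₁))(L⁺_v)` carrying the record pins ★ `IsRecordDatumG` (the K2E3 organ's G-side pins verbatim) satisfies ★ `ExtE3FinDatum` (Weyl integration
formula + companions, Prop. 12.6.1 (a) + `L²`-on-tori, Kazhdan pseudo-coefficients + trace identity + `E²(G) ⊂` elliptic).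
Socket 2 closes when a ★ `Theorems` file proves `theorem … : ExtE3Tw` (f2 `CharRegularTw` E3.P2, f9 `KRTwistedDensity` E3.P7.3, f10 `TwCasselmanProp74` E3.P9, at the ★ S4
twisted carriers of record `GtLoc`∕`epsLoc`).  ED. 2 (named junctions of HEADS-C.v1 §3, each folded when its carrier∕pins of record exist, as an ADDITIONAL closed socket or
a new ★ defs field + head): J-E3-LABELS (E3.P6 label relations, E3.P11), J-E3-STABLE, J-E3-GERMS
(E3.P4), J-E3-R4 (E3.R4), J-E3-REG-SPLIT ∕ J-E3-REG-H (character regularity at split places ∕ on `H_v` as such, outside LeThree); BY REFERENCE ONLY (no field, no import; cycle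
rule): (E6) `hcFiniteLevel` (E3.P13) = S10-A's socket, and row «E3-c: Harish-Chandra admissibility ∕ rigidity at ∞» = the S9 Defs binder `hF1b` (LEAD #32 (K)); f12
(E3.P12) OFF; [KyS] not typed.  DIGITS: «closure sockets typed 4∕4 (E3 ED. 1: 11 fields live = 8 + 3 twisted, 5 by junction)».  EDITION PRINCIPLE (dealer 22:25:57Z):
additive only — `stub_R90_ext_E3 : ExtE3CM`, `stub_R90_ext_E3_tw : ExtE3Tw` and every head below are byte-preserved; new rows arrive as additional closed sockets (E1's
`_arch` precedent); the ONE ruled exception of record is ED. 2's type weakening `ExtE3` ↦ `ExtE3CM` at socket 1 (J-34-9 ∕ LEAD #40, labelled above).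

Sorries = exactly TWO (the two sockets).  No `instance`, no `notation`, no `Cruxes/…/Lines` import.  Namespace `Summit.HodgeConjecture.HodgeConjecture.R90.S1`.

HONEST LABEL.  HC_CM is proved only modulo the 7 printed citations (2 remaining named inputs: hLiu418 = stmt-HodgeConjecture-24832, h413 = stmt-HodgeConjecture-24833)
until rung 0 closes; this file closes NOTHING at rung 0 — it TYPES the (E3) build target; REL ≠ ★ ≠ BUILT.

References: [cite: Rogawski1990, §1.6 pp. 5–6; §12.5 pp. 182–184; §12.6 Prop. 12.6.1 pp. 187–189; §12.7 p. 193; §13.8 Prop. 13.8.1 p. 212, p. 218; §8.2 p. 119]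
[cite: HarishChandra1999AdmissibleDistributions, Part III §16 Thm. 16.3] [cite: Kazhdan1986CuspidalGeometry, Thm. K] [cite: Clozel1989] [cite: ClozelDelorme1984]
[cite: Varadarajan1989, §6.4] [cite: LabesseLanglands1979, Lemma 6.1] [cite: Clozel1987, Thm. 1] [cite: KottwitzRogawski2000] [cite: Rogawski1988TwistedPaleyWiener, Prop. 7.4]
-/

set_option autoImplicit false
-- the mandated namespace has the single-problem summit's repeated segment (`HodgeConjecture.HodgeConjecture`)
set_option linter.dupNamespace false

open MeasureTheory Measure Filter Topology NumberField IsDedekindDomain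
open scoped NNReal Matrix MatrixGroups
open Literature.NumberTheory.Rogawski1990 Literature.NumberTheory.Rogawski1990.Ch12Sec5
open Literature.NumberTheory.Automorphic Literature.NumberTheory.Automorphic.UnitaryGroup
open Summit.HodgeConjecture.HodgeConjecture.Cruxes.H413.K2E1bGKCohomologyU21.U8 (ArchPacketSignsLetter)
open Summit.HodgeConjecture.HodgeConjecture.Cruxes.H413.K2E3CharLettersLeThreeDefs (characterLocallyIntegrableLeThree normalizedCharacter_locallyBoundedLeThree)

namespace Summit.HodgeConjecture.HodgeConjecture.R90.S1

/-! ## §1 The two closure sockets of record (the ONLY sorries of this file) -/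

section Socket

/-- **(E3) CLOSURE SOCKET OF RECORD = BUILD TARGET (NR-4 FINAL; R90_CLOSURE_DAG rows E3.P1 P3 P5 P6 P10 R1 R2 R5) — «local harmonic analysis»: `ExtE3CM` (ED. 2: rows E3.R2
CM-BOUND — J-34-9 ∕ LEAD #40 WEAKENING OF RECORD; ED. 1 typed ★ `ExtE3`, which implies it by ★ `ExtE3.toCM`).**
CLOSURE TARGET (R90_CLOSURE_DAG row E3): the conjunction ★ `ExtE3CM = ExtE3Fin ∧ ExtE3ArchCM` of ★ `R90S1ClosureE3DefsCM` (over ★ `R90S1ClosureE3Defs`) — Harish-Chandra regularity of characters and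
local boundedness of `|D|^{1∕2}χ_π` for `U(N)`, `2 ≤ N ≤ 3`, at non-split places (§1.6 p. 5, §12.7 p. 193, [H₁] Thm 16.3; the ★ LeThree letters), and, at every non-split finite place for every record-pinned §12.5 datum, the Weyl
integration formula (§12.5 p. 182), Prop. 12.6.1 (a) with `D_G χ_π ∈ L²(T)` (pp. 184, 187–188), Kazhdan's pseudo-coefficients, `Tr π′(f_π) = ⟨χ_{π′}, χ_π⟩_e` and
`E²(G) ⊂` elliptic (p. 187, [K]); at ∞: Clozel–Delorme pseudo-coefficients (§13.8 p. 218), Harish-Chandra's limit formula at a noncompact wall (§8.2 p. 119), linear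
independence of characters (Prop. 13.8.1 p. 212); at ∞ the limit-formula rows bind CM number fields `L` (the ★ payers' binders).  OWNER S1; NEVER dealt to provers,
NEVER `skeleton check`ed, FROZEN once written; it closes only by a ★ `Theorems` proof `theorem … : ExtE3CM` assembled from the payers' conjuncts (BUILD, not citation).
[cite: Rogawski1990, §1.6 p. 5; §12.5 p. 182, p. 184; §12.6 Prop. 12.6.1 (a) pp. 187–188; §12.7 p. 193; §13.8 p. 212, p. 218; §8.2 p. 119]
[cite: HarishChandra1999AdmissibleDistributions, Part III §16 Thm. 16.3] [cite: Kazhdan1986CuspidalGeometry, Thm. K] [cite: ClozelDelorme1984] -/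
theorem stub_R90_ext_E3 : ExtE3CM := by
  sorry

/-- **(E3, ε-TWISTED) CLOSURE SOCKET OF RECORD = BUILD TARGET (NR-4 FINAL; R90_CLOSURE_DAG rows E3.P2 P7.3 P9) — the ε-twisted closure inputs: `ExtE3Tw`.**
CLOSURE TARGET (R90_CLOSURE_DAG row E3, twisted part): the closed bundle ★ `ExtE3Tw` of ★ `R90S1ClosureE3TwistedDefs` (typ1 (g2), p862674) — [C₂] Clozel's twisted
character regularity `CharRegularTw` (§12.7 pp. 196–197), [KR] the Kottwitz–Rogawski twisted density in its (∗)-form `KRTwistedDensity` (§13.8 pp. 223–224), [R₃]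
Rogawski 1988 Prop. 7.4 (twisted Casselman) `TwCasselmanProp74` — each ∀-closed over the ★ S4 twisted carriers of record (`GtLoc L w`, `epsLoc`).  OWNER S1; NEVER dealt
to provers, NEVER `skeleton check`ed, FROZEN once written; it closes only by a ★ `Theorems` proof `theorem … : ExtE3Tw` (BUILD, not citation).
[cite: Rogawski1990, §1.6 pp. 5–6; §12.7 pp. 196–197; §13.8 pp. 223–224] [cite: Clozel1987, Thm. 1] [cite: KottwitzRogawski2000]
[cite: Rogawski1988TwistedPaleyWiener, Prop. 7.4] -/
theorem stub_R90_ext_E3_tw : ExtE3Tw := by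
  sorry

end Socket

/-! ## §2 Projection heads (sorry-free; `#print axioms` of each = {propext, Classical.choice, Quot.sound} + `sorryAx` via its own socket ONLY) -/

section Heads

/-- (E3, finite places) the finite half of the socket. [cite: Rogawski1990, §12.5 p. 182] -/
theorem extE3Fin_of_extE3 : ExtE3Fin := stub_R90_ext_E3.1

/-- (E3, real places) the archimedean half of the socket (ED. 2: ★ `ExtE3ArchCM`, rows E3.R2 CM-bound, J-34-9). [cite: Rogawski1990, §13.8 p. 218] -/
theorem extE3Arch_of_extE3 : ExtE3ArchCM := stub_R90_ext_E3.2

/-- Row E3.P1 — Harish-Chandra regularity for `2 ≤ N ≤ 3` at non-split places ★ `characterLocallyIntegrableLeThree` (R-S1-7′ (α); = the TYPE of the K2E3 organ's L4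
tier-0 ED. 4 stub 1; the ∀ `N` ★ `Ch1.characterLocallyIntegrable` is NR-1′ S-layer, not consumed by HC_CM). [cite: Rogawski1990, §1.6 p. 5]
[cite: HarishChandra1999AdmissibleDistributions, Part III §16 Thm. 16.3] -/
theorem regularity_of_extE3 : characterLocallyIntegrableLeThree := stub_R90_ext_E3.1.regularity

/-- Row E3.P10 — `|D_G|^{1∕2} χ_π` locally bounded for `2 ≤ N ≤ 3` at non-split places ★ `normalizedCharacter_locallyBoundedLeThree` (R-S1-7′ (α); = the TYPE of the
organ's L4 tier-0 ED. 4 stub 2). [cite: HarishChandra1999AdmissibleDistributions, Part III §16 Thm. 16.3] [cite: Rogawski1990, §12.7 p. 193] -/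
theorem normCharLocBdd_of_extE3 : normalizedCharacter_locallyBoundedLeThree := stub_R90_ext_E3.1.normCharLocBdd

/-- Rows E3.P3 P5 P6 — at the record frame (CM field `L`, non-split finite place `v`, Haar `νQv` on `U(Φ₃)(L⁺_v)`, Haar `μZ` on `G ⧸ Z`, canonical orbital family `mQv`),
every record-pinned §12.5 datum satisfies the fielded relations ★ `ExtE3FinDatum` (Weyl integration formula + companions; Prop. 12.6.1 (a) + `L²` on tori; Kazhdan's
pseudo-coefficients + trace identity + `E²(G) ⊂` elliptic). [cite: Rogawski1990, §12.5 p. 182, p. 184; §12.6 p. 187] [cite: Kazhdan1986CuspidalGeometry, Thm. K] -/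
theorem extE3FinDatum_of_extE3 (L : Type) [Field L] [NumberField L] [IsCMField L] (v : HeightOneSpectrum (𝓞 ↥(maximalRealSubfield L)))
    (hv : ∀ w : PlacesOver L v, IsCMField.complexConj L • w.1 = w.1)
    [MeasurableSpace (Gqs L v)] [BorelSpace (Gqs L v)]
    [∀ γ : Gqs L v, MeasurableSpace (Gqs L v ⧸ Subgroup.centralizer ({γ} : Set (Gqs L v)))]
    [∀ γ : Gqs L v, BorelSpace (Gqs L v ⧸ Subgroup.centralizer ({γ} : Set (Gqs L v)))]
    [MeasurableSpace (Gqs L v ⧸ Subgroup.center (Gqs L v))] [BorelSpace (Gqs L v ⧸ Subgroup.center (Gqs L v))]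
    [MeasurableSpace ((UnitaryGroup.cmDatum L 2 (Matrix.of fun i j : Fin 2 => if i.val + j.val + 1 = 2 then (1 : L) else 0)).Local v ×
      (UnitaryGroup.cmDatum L 1 (Matrix.of fun i j : Fin 1 => if i.val + j.val + 1 = 1 then (1 : L) else 0)).Local v)]
    (νQv : Measure (Gqs L v)) [νQv.IsHaarMeasure] [νQv.IsMulRightInvariant]
    (μZ : Measure (Gqs L v ⧸ Subgroup.center (Gqs L v))) [μZ.IsHaarMeasure]
    (mQv : OrbitalMeasureFamily (Gqs L v))
    (hm : mQv.IsCanonical (fun γ => IsRegularElt (γ.val : GL (Fin 3) (UnitaryGroup.LocalRing L v))) νQv)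
    (𝔇 : EllipticData (Gqs L v)
      ((UnitaryGroup.cmDatum L 2 (Matrix.of fun i j : Fin 2 => if i.val + j.val + 1 = 2 then (1 : L) else 0)).Local v ×
        (UnitaryGroup.cmDatum L 1 (Matrix.of fun i j : Fin 1 => if i.val + j.val + 1 = 1 then (1 : L) else 0)).Local v))
    (h𝔇 : IsRecordDatumG L v νQv μZ mQv 𝔇) : ExtE3FinDatum L v 𝔇 :=
  stub_R90_ext_E3.1.datum L v hv νQv μZ mQv hm 𝔇 h𝔇

/-- Row E3.R1 — Clozel–Delorme pseudo-coefficients in the engine's form, the ★ E1b letter `ArchPacketSignsLetter` (= the TYPE of S10-E's `stub_R90_ext_pseudoCoeffDS_u`;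
one E3 build closes E1b U8, S10 E-X1 and this row). [cite: Rogawski1990, §13.8 p. 218] [cite: ClozelDelorme1984] -/
theorem archPacketSigns_of_extE3 : ArchPacketSignsLetter := stub_R90_ext_E3.2.cdPseudoCoeff

/-- Row E3.R2 (one-sided limits) ★ `ArchTorusOrbitalOneSidedLimits` at a CM number field `L` (ED. 2: CM-bound, J-34-9; = the TYPE of ★ `archTorusOrbitalOneSidedLimits_holds L α w`).
[cite: Varadarajan1989, §6.4 Thm 18, Thm 20] [cite: Rogawski1990, §8.2 p. 119] -/
theorem archLimitOneSided_of_extE3 (L : Type) [Field L] [NumberField L] [IsCMField L] (α : Fin 3 → L) (w : {w : InfinitePlace L // InfinitePlace.IsComplex w}) :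
    ArchTorusOrbitalOneSidedLimits L α w :=
  stub_R90_ext_E3.2.archLimitOneSided L α w

/-- Row E3.R2 (the limit formula at a noncompact wall) ★ `ArchLimitFormulaNoncompactWall` at a CM number field `L` (ED. 2: CM-bound, J-34-9; = the TYPE of ★
`archLimitFormulaNoncompactWall_holds L α w`). [cite: Varadarajan1989, §6.4 Thm 22] [cite: Rogawski1990, §8.2 p. 119] -/
theorem archLimitFormula_of_extE3 (L : Type) [Field L] [NumberField L] [IsCMField L] (α : Fin 3 → L) (w : {w : InfinitePlace L // InfinitePlace.IsComplex w}) :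
    ArchLimitFormulaNoncompactWall L α w :=
  stub_R90_ext_E3.2.archLimitFormula L α w

/-- Row E3.R5 — linear independence of characters on `G′_∞ ∕ K_c` ★ `ArchCharactersLinIndep` (Prop. 13.8.1). [cite: Rogawski1990, Prop. 13.8.1 p. 212]
[cite: LabesseLanglands1979, Lemma 6.1 pp. 768–769] -/
theorem archCharLinIndep_of_extE3 (L : Type) [Field L] [NumberField L] [IsCMField L] (ι : L →+* ℂ) (H : Matrix (Fin 3) (Fin 3) L) (T : GL (Fin 3) ℂ)
    (hT : (T : Matrix (Fin 3) (Fin 3) ℂ)ᴴ * H.map ι * (T : Matrix (Fin 3) (Fin 3) ℂ) = Literature.Geometry.ComplexHyperbolic.BallModel.J)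
    (νinf : @Measure (UnitaryGroup.arch (↥(maximalRealSubfield L)) L (IsCMField.complexConj L) 3 H) (borel _)) :
    ArchCharactersLinIndep L ι H T hT νinf :=
  stub_R90_ext_E3.2.archCharLinIndep L ι H T hT νinf

/-- Row E3.P2 — [C₂] twisted character regularity ★ `CharRegularTw` (via socket 2). [cite: Clozel1987, Thm. 1] [cite: Rogawski1990, §12.7 pp. 196–197] -/
theorem charRegularTw_of_extE3Tw : CharRegularTw := stub_R90_ext_E3_tw.charRegularTw

/-- Row E3.P7.3 — [KR] twisted density, (∗)-form ★ `KRTwistedDensity` (via socket 2). [cite: KottwitzRogawski2000] [cite: Rogawski1990, §13.8 pp. 223–224] -/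
theorem krTwistedDensity_of_extE3Tw : KRTwistedDensity := stub_R90_ext_E3_tw.krTwistedDensity

/-- Row E3.P9 — [R₃] Prop. 7.4, twisted Casselman ★ `TwCasselmanProp74` (via socket 2). [cite: Rogawski1988TwistedPaleyWiener, Prop. 7.4] [cite: Rogawski1990, §12.7 p. 196] -/
theorem twCasselmanProp74_of_extE3Tw : TwCasselmanProp74 := stub_R90_ext_E3_tw.twCasselmanProp74

end Heads

end Summit.HodgeConjecture.HodgeConjecture.R90.S1
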